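import Mathlib
import Literature.Combinatorics.Games.MeanPayoffGame
import HarnessLib

/-!
# Mean-payoff games: proof of positional determinacy (threshold form)

Topic `Literature/Combinatorics/Games`; companion of `MeanPayoffGame.lean`, whose named fact
`MeanPayoffGame.EhrenfeuchtMycielski1979_thresholdDichotomy` (Ehrenfeucht–Mycielski 1979: on a
dead-end-free finite arena with integer weights, for every start vertex and integer threshold
`θ`, either Max has a positional strategy forcing lasso cycles of mean weight `≥ θ` against
every positional strategy of Min, or Min has one forcing mean weight `< θ`) is DISCHARGED here:
`MeanPayoffGame.EhrenfeuchtMycielski1979_thresholdDichotomy_holds`.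

## The proof formalized

Not the first-cycle-game proof printed for Cor. "Positional determinacy of mean payoff" in
Fijalkow et al., *Games on Graphs*, Ch. 4 § "Proving positional determinacy over finite arenas"
(that argument needs general strategies and finite-duration determinacy, which the positional
layer of `ParityGame.lean` / `MeanPayoffGame.lean` deliberately does not carry), but the
discounted-game road of the same chapter, § "Discounted payoff games", which stays inside
positional strategies throughout:

1. `exists_fixedPt_of_abs_le` — Banach fixed point on `V → ℝ` (sup metric) for coordinatewise
   `λ`-Lipschitz self-maps, `λ < 1` (ibid., Fact "the operator is contracting");
   `exists_discountedEval` — the discounted evaluation `D u = c u + λ · D (g u)` of a functional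
   graph `g` (the play map of a pair of positional strategies) with rewards `c`.
2. `le_discountedEval` / `discountedEval_le` — comparison principle by a minimum argument:
   sub/supersolutions of the affine recursion lie below/above its solution (no limits).
3. `discountedEval_closedForm` — for the lasso orbit of `v` under `g` with cycle of length `p`
   entered by time `t₀`: `(1-λ) · D v = (A'(λ) - λ^p · A(λ)) / (1 + λ + ⋯ + λ^{p-1})` with
   `A`, `A'` the discounted prefix sums of lengths `t₀`, `t₀ + p`; a rational function
   continuous at `λ = 1` whose value there is the mean reward of the cycle (ibid., the opening
   computation `(1-λ) ∑ λ^i w_i → (1/r) ∑_{j<r} w_j`). The cycle (`infinitelyOften` of the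
   orbit) is identified with the orbit of a periodic point via `Function.minimalPeriod` and
   `Function.iterate_injOn_Iio_minimalPeriod`.
4. `exists_discounted_saddle` — from the fixed point `x` of the one-step (Shapley) operator,
   argmax/argmin positional strategies `σ*`, `τ*` with `D_{σ,τ*} ≤ x ≤ D_{σ*,τ}` for all
   positional `σ`, `τ` legal at their owner's vertices (ibid., Lemma "Values as unique fixed
   point").
5. `exists_cycleMean_saddle` — `λ_k = 1 - 1/(k+1) → 1`; one pair `(σ*, τ*)` is a discounted
   saddle for infinitely many `k` (pigeonhole over the finite set of positional pairs,
   `Filter.extraction_of_frequently_atTop`); multiplying by `1 - λ_k` and passing to the limit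
   along that subsequence gives a saddle point for the cycle-mean payoff among positional
   strategies (the Blackwell-optimality argument).
6. `EhrenfeuchtMycielski1979_thresholdDichotomy_holds` — compare the integer threshold with the
   saddle: if some legal `σ` reaches `θ` against `τ*`, then `σ*` guarantees `θ` against every
   legal `τ`; otherwise `τ*` keeps every legal `σ` below `θ` (casts `ℤ → ℝ` only).

Helpers are `private`; nothing here is a definition or a new named fact.

## References

* A. Ehrenfeucht, J. Mycielski, *Positional strategies for mean payoff games*, Int. J. Game
  Theory 8 (1979) 109–113. [EhrenfeuchtMycielski1979]
* N. Fijalkow et al., *Games on Graphs*, arXiv:2305.10546 (2023), Ch. 4 (N. Fijalkow,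
  B. Monmege, *Games with Payoffs*), § "Proving positional determinacy over finite arenas",
  Cor. "Positional determinacy of mean payoff"; § "Discounted payoff games", Fact "contracting",
  Lemma "Values as unique fixed point", and the opening lasso computation.
  [FijalkowEtAl2023GamesOnGraphs]
-/

namespace Literature.Combinatorics.Games

open Finset Filter Function

open scoped Classical

universe u

namespace MeanPayoffGame

section DeterminacyProof

variable {V : Type*} [Fintype V]

/-- Perturbation bound for `Finset.sup'` over `ℝ`: if `|F b - G b| ≤ d` on `s` then the two
suprema differ by at most `d`. [folklore] -/
private theorem abs_sup'_sub_sup'_le {β : Type*} {s : Finset β} (hs : s.Nonempty)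
    {F G : β → ℝ} {d : ℝ} (h : ∀ b ∈ s, |F b - G b| ≤ d) :
    |s.sup' hs F - s.sup' hs G| ≤ d := by
  rw [abs_sub_le_iff]
  constructor
  · rw [sub_le_iff_le_add]
    refine Finset.sup'_le hs F fun b hb => ?_
    have h1 := (abs_sub_le_iff.1 (h b hb)).1
    have h2 : G b ≤ s.sup' hs G := Finset.le_sup' G hb
    linarith
  · rw [sub_le_iff_le_add]
    refine Finset.sup'_le hs G fun b hb => ?_
    have h1 := (abs_sub_le_iff.1 (h b hb)).2
    have h2 : F b ≤ s.sup' hs F := Finset.le_sup' F hb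
    linarith

/-- Perturbation bound for `Finset.inf'` over `ℝ`. [folklore] -/
private theorem abs_inf'_sub_inf'_le {β : Type*} {s : Finset β} (hs : s.Nonempty)
    {F G : β → ℝ} {d : ℝ} (h : ∀ b ∈ s, |F b - G b| ≤ d) :
    |s.inf' hs F - s.inf' hs G| ≤ d := by
  rw [abs_sub_le_iff]
  constructor
  · rw [sub_le_iff_le_add, ← sub_le_iff_le_add']
    refine Finset.le_inf' hs G fun b hb => ?_
    have h1 := (abs_sub_le_iff.1 (h b hb)).1
    have h2 : s.inf' hs F ≤ F b := Finset.inf'_le F hb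
    linarith
  · rw [sub_le_iff_le_add, ← sub_le_iff_le_add']
    refine Finset.le_inf' hs F fun b hb => ?_
    have h1 := (abs_sub_le_iff.1 (h b hb)).2
    have h2 : s.inf' hs G ≤ G b := Finset.inf'_le G hb
    linarith

/-- Banach fixed point for self-maps of `V → ℝ` (sup metric, `V` finite) that are coordinatewise
`λ`-Lipschitz with `λ < 1`. [folklore] -/
private theorem exists_fixedPt_of_abs_le {lam : ℝ} (h0 : 0 ≤ lam) (h1 : lam < 1)
    (T : (V → ℝ) → V → ℝ) (hT : ∀ x y u, |T x u - T y u| ≤ lam * dist x y) :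
    ∃ x : V → ℝ, T x = x := by
  set K : NNReal := ⟨lam, h0⟩ with hK
  have hLip : LipschitzWith K T := by
    refine LipschitzWith.of_dist_le_mul fun x y => ?_
    refine (dist_pi_le_iff (mul_nonneg h0 dist_nonneg)).2 fun u => ?_
    rw [Real.dist_eq]
    exact hT x y u
  have hC : ContractingWith K T := ⟨by
    show (⟨lam, h0⟩ : NNReal) < 1
    exact_mod_cast h1, hLip⟩
  exact ⟨ContractingWith.fixedPoint T hC, ContractingWith.fixedPoint_isFixedPt hC⟩

/-- The discounted evaluation `D` of a functional graph `g` with vertex rewards `c`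
(`D u = c u + λ · D (g u)`) exists for `0 ≤ λ < 1`. [folklore] -/
private theorem exists_discountedEval {lam : ℝ} (h0 : 0 ≤ lam) (h1 : lam < 1) (g : V → V)
    (c : V → ℝ) : ∃ D : V → ℝ, ∀ u, D u = c u + lam * D (g u) := by
  obtain ⟨D, hD⟩ := exists_fixedPt_of_abs_le h0 h1 (fun x u => c u + lam * x (g u))
    (fun x y u => by
      have hb : |x (g u) - y (g u)| ≤ dist x y := by
        rw [← Real.dist_eq]; exact dist_le_pi_dist x y (g u)
      calc |c u + lam * x (g u) - (c u + lam * y (g u))| = |lam * (x (g u) - y (g u))| := by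
            congr 1; ring
        _ = lam * |x (g u) - y (g u)| := by rw [abs_mul, abs_of_nonneg h0]
        _ ≤ lam * dist x y := mul_le_mul_of_nonneg_left hb h0)
  exact ⟨D, fun u => (congrFun hD u).symm⟩

/-- Comparison principle (minimum argument): a `λ`-subsolution lies below the discounted
evaluation. [folklore] -/
private theorem le_discountedEval {lam : ℝ} (h0 : 0 ≤ lam) (h1 : lam < 1) {g : V → V}
    {c : V → ℝ} {D x : V → ℝ} (hD : ∀ u, D u = c u + lam * D (g u))
    (hx : ∀ u, x u ≤ c u + lam * x (g u)) : ∀ u, x u ≤ D u := by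
  rcases isEmpty_or_nonempty V with hV | hV
  · intro u; exact isEmptyElim u
  obtain ⟨u0, -, hu0⟩ :=
    Finset.exists_min_image Finset.univ (fun u => D u - x u) Finset.univ_nonempty
  have hmin : D u0 - x u0 ≤ D (g u0) - x (g u0) := hu0 _ (Finset.mem_univ _)
  have hstep : lam * (D (g u0) - x (g u0)) ≤ D u0 - x u0 := by
    rw [mul_sub, hD u0]; linarith [hx u0]
  have hle : lam * (D u0 - x u0) ≤ D u0 - x u0 := (mul_le_mul_of_nonneg_left hmin h0).trans hstep
  have hnonneg : 0 ≤ D u0 - x u0 := by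
    by_contra hneg
    have key : (1 - lam) * (D u0 - x u0) < 0 :=
      mul_neg_of_pos_of_neg (sub_pos.2 h1) (not_le.1 hneg)
    rw [sub_mul, one_mul] at key
    linarith
  intro u
  have := hu0 u (Finset.mem_univ u)
  linarith

/-- Dual comparison principle: a `λ`-supersolution lies above the discounted evaluation.
[folklore] -/
private theorem discountedEval_le {lam : ℝ} (h0 : 0 ≤ lam) (h1 : lam < 1) {g : V → V}
    {c : V → ℝ} {D x : V → ℝ} (hD : ∀ u, D u = c u + lam * D (g u))
    (hx : ∀ u, c u + lam * x (g u) ≤ x u) : ∀ u, D u ≤ x u := by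
  have hD' : ∀ u, (-D) u = (-c) u + lam * (-D) (g u) := fun u => by
    simp only [Pi.neg_apply]; rw [hD u]; ring
  have hx' : ∀ u, (-x) u ≤ (-c) u + lam * (-x) (g u) := fun u => by
    simp only [Pi.neg_apply]; linarith [hx u]
  intro u
  have := le_discountedEval h0 h1 hD' hx' u
  simp only [Pi.neg_apply] at this
  linarith

/-- **Closed form of the discounted evaluation of a lasso.** For a functional graph `g`,
rewards `c` and start `v` there is a function `H`, continuous at `1` with value the mean reward
of the cycle `C` of the orbit of `v` (`H λ → (∑_{u ∈ C} c u) / |C|` as `λ → 1`), such that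
`(1 - λ) · D v = H λ` for every `0 ≤ λ < 1` and every `D` with `D u = c u + λ · D (g u)`;
`C = infinitelyOften (t ↦ g^[t] v)`. This is the computation
`(1-λ) ∑ λ^i w_i → (1/r) ∑_{j<r} w_j` for ultimately periodic weight sequences.
[cite: FijalkowEtAl2023GamesOnGraphs, Ch. 4 § "Discounted payoff games" (opening computation)] -/
private theorem discountedEval_closedForm (g : V → V) (c : V → ℝ) (v : V) :
    ∃ H : ℝ → ℝ,
      Tendsto H (nhds 1) (nhds ((∑ u ∈ infinitelyOften (fun t => g^[t] v), c u) /
        ((infinitelyOften (fun t => g^[t] v)).card : ℝ))) ∧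
      ∀ lam : ℝ, 0 ≤ lam → lam < 1 → ∀ D : V → ℝ, (∀ u, D u = c u + lam * D (g u)) →
        (1 - lam) * D v = H lam := by
  obtain ⟨u1, hu1⟩ := infinitelyOften_nonempty (fun t => g^[t] v)
  obtain ⟨⟨t0, ht0⟩, q, hq, hqu⟩ := mem_infinitelyOften_iterate_iff.1 hu1
  have hper : u1 ∈ periodicPts g := mk_mem_periodicPts hq hqu
  have hp0 : 0 < minimalPeriod g u1 := minimalPeriod_pos_of_mem_periodicPts hper
  have hpu : g^[minimalPeriod g u1] u1 = u1 := iterate_minimalPeriod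
  -- the cycle is the orbit of `u1`
  have hCimg : infinitelyOften (fun t => g^[t] v) =
      (range (minimalPeriod g u1)).image (fun j => g^[j] u1) := by
    ext u
    simp only [mem_infinitelyOften_iterate_iff, mem_image, mem_range]
    constructor
    · rintro ⟨⟨t, ht⟩, r, hr, hru⟩
      have hm : ∃ m, g^[m] u1 = u := by
        rcases le_or_gt t0 t with h | h
        · refine ⟨t - t0, ?_⟩
          rw [← ht0, ← iterate_add_apply, Nat.sub_add_cancel h, ht]
        · have hu_per : g^[r * t0] u = u := (IsPeriodicPt.mul_const hru t0 : IsPeriodicPt g _ u)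
          have hu1' : g^[t0 - t] u = u1 := by
            rw [← ht, ← iterate_add_apply, Nat.sub_add_cancel h.le, ht0]
          have hle : t0 - t ≤ r * t0 :=
            (Nat.sub_le t0 t).trans (Nat.le_mul_of_pos_left t0 hr)
          refine ⟨r * t0 - (t0 - t), ?_⟩
          calc g^[r * t0 - (t0 - t)] u1 = g^[r * t0 - (t0 - t)] (g^[t0 - t] u) := by rw [hu1']
            _ = g^[r * t0] u := by rw [← iterate_add_apply, Nat.sub_add_cancel hle]
            _ = u := hu_per
      obtain ⟨m, hm⟩ := hm
      exact ⟨m % minimalPeriod g u1, Nat.mod_lt _ hp0, by rw [iterate_mod_minimalPeriod_eq, hm]⟩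
    · rintro ⟨j, -, rfl⟩
      refine ⟨⟨j + t0, by rw [iterate_add_apply, ht0]⟩, minimalPeriod g u1, hp0, ?_⟩
      rw [← iterate_add_apply, add_comm, iterate_add_apply, hpu]
  have hinj : Set.InjOn (fun j => g^[j] u1) ↑(range (minimalPeriod g u1)) := by
    rw [coe_range]; exact iterate_injOn_Iio_minimalPeriod
  have hcard : (infinitelyOften (fun t => g^[t] v)).card = minimalPeriod g u1 := by
    rw [hCimg, card_image_of_injOn hinj, card_range]
  have hsum : ∑ u ∈ infinitelyOften (fun t => g^[t] v), c u =
      ∑ j ∈ range (minimalPeriod g u1), c (g^[j] u1) := by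
    rw [hCimg, sum_image fun x hx y hy hxy => hinj hx hy hxy]
  set p := minimalPeriod g u1 with hp
  refine ⟨fun μ => ((∑ t ∈ range (p + t0), μ ^ t * c (g^[t] v)) -
      μ ^ p * ∑ t ∈ range t0, μ ^ t * c (g^[t] v)) / ∑ j ∈ range p, μ ^ j, ?_, ?_⟩
  · have hnum : Continuous fun μ : ℝ => (∑ t ∈ range (p + t0), μ ^ t * c (g^[t] v)) -
        μ ^ p * ∑ t ∈ range t0, μ ^ t * c (g^[t] v) := by fun_prop
    have hden : Continuous fun μ : ℝ => ∑ j ∈ range p, μ ^ j := by fun_prop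
    have key := ((hnum.continuousAt (x := (1 : ℝ))).div (hden.continuousAt (x := (1 : ℝ)))
      (by simp [hp0.ne'])).tendsto
    have hmean : (∑ u ∈ infinitelyOften (fun t => g^[t] v), c u) /
        ((infinitelyOften (fun t => g^[t] v)).card : ℝ) =
        ((∑ t ∈ range (p + t0), (1 : ℝ) ^ t * c (g^[t] v)) -
          1 ^ p * ∑ t ∈ range t0, 1 ^ t * c (g^[t] v)) / ∑ j ∈ range p, (1 : ℝ) ^ j := by
      rw [hcard, hsum]
      simp only [one_pow, one_mul, Finset.sum_const, card_range, nsmul_eq_mul, mul_one]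
      congr 1
      have hsplit := Finset.sum_range_add_sum_Ico (fun t => c (g^[t] v)) (Nat.le_add_left t0 p)
      rw [Finset.sum_Ico_eq_sum_range, Nat.add_sub_cancel] at hsplit
      have hshift : ∑ k ∈ range p, c (g^[t0 + k] v) = ∑ j ∈ range p, c (g^[j] u1) :=
        sum_congr rfl fun j _ => by rw [add_comm, iterate_add_apply, ht0]
      linarith [hsplit, hshift]
    rw [hmean]
    exact key
  · intro lam hl0 hl1 D hD
    have hiter : ∀ N u, D u = (∑ t ∈ range N, lam ^ t * c (g^[t] u)) + lam ^ N * D (g^[N] u) := by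
      intro N
      induction N with
      | zero => intro u; simp
      | succ N ih =>
        intro u
        rw [Finset.sum_range_succ, pow_succ, iterate_succ_apply', ih u, hD (g^[N] u)]
        ring
    have h1' := hiter t0 v
    have h2' := hiter (p + t0) v
    rw [iterate_add_apply, ht0, hpu, pow_add] at h2'
    rw [ht0] at h1'
    have hden_pos : 0 < ∑ j ∈ range p, lam ^ j := by
      have h01 : (1 : ℝ) ≤ ∑ j ∈ range p, lam ^ j := by
        have := Finset.single_le_sum (f := fun j => lam ^ j) (fun j _ => pow_nonneg hl0 j)
          (mem_range.2 hp0)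
        simpa using this
      linarith
    rw [eq_div_iff hden_pos.ne']
    have hgeom : (1 - lam) * ∑ j ∈ range p, lam ^ j = 1 - lam ^ p := mul_neg_geom_sum lam p
    linear_combination (D v) * hgeom + h2' - lam ^ p * h1'

/-- **Optimal positional strategies of the discounted game** (Shapley; Games on Graphs, Ch. 4,
Lemma "Values as unique fixed point"): for `0 ≤ λ < 1`, from the fixed point `x` of the
contracting one-step operator one reads off positional strategies `σ*` (argmax) and `τ*`
(argmin), legal everywhere, such that for all positional `σ` (legal at Max's vertices) and `τ`
(legal at Min's vertices) the discounted evaluations satisfy `D_{σ,τ*} ≤ x ≤ D_{σ*,τ}`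
pointwise. [cite: FijalkowEtAl2023GamesOnGraphs, Ch. 4 § "Discounted payoff games", Fact "contracting" and Lemma "Values as unique fixed point"] -/
private theorem exists_discounted_saddle (o : V → Bool) (w : V → V → ℤ) (E : V → V → Prop)
    (hE : ∀ u, ∃ u', E u u') {lam : ℝ} (h0 : 0 ≤ lam) (h1 : lam < 1) :
    ∃ σs τs : V → V, (∀ u, E u (σs u)) ∧ (∀ u, E u (τs u)) ∧
      ∀ σ τ : V → V, (∀ u, o u = true → E u (σ u)) → (∀ u, o u = false → E u (τ u)) →
        ∀ D₁ D₂ : V → ℝ,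
          (∀ u, D₁ u = (w u (positionalPlay o σ τs u) : ℝ) + lam * D₁ (positionalPlay o σ τs u)) →
          (∀ u, D₂ u = (w u (positionalPlay o σs τ u) : ℝ) + lam * D₂ (positionalPlay o σs τ u)) →
            ∀ u, D₁ u ≤ D₂ u := by
  -- successor sets and the one-step operator
  set S : V → Finset V := fun u => Finset.univ.filter fun u' => E u u' with hSd
  have hmemS : ∀ u b, b ∈ S u ↔ E u b := fun u b => by simp [hSd]
  have hS : ∀ u, (S u).Nonempty := fun u => by
    obtain ⟨u', hu'⟩ := hE u
    exact ⟨u', (hmemS u u').2 hu'⟩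
  set F : (V → ℝ) → V → V → ℝ := fun x u u' => (w u u' : ℝ) + lam * x u' with hFd
  set T : (V → ℝ) → V → ℝ := fun x u =>
    if o u = true then (S u).sup' (hS u) (F x u) else (S u).inf' (hS u) (F x u) with hTd
  have hF : ∀ x y : V → ℝ, ∀ u b, |F x u b - F y u b| ≤ lam * dist x y := by
    intro x y u b
    have hb : |x b - y b| ≤ dist x y := by
      rw [← Real.dist_eq]; exact dist_le_pi_dist x y b
    calc |F x u b - F y u b| = |lam * (x b - y b)| := by rw [hFd]; congr 1; ring
      _ = lam * |x b - y b| := by rw [abs_mul, abs_of_nonneg h0]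
      _ ≤ lam * dist x y := mul_le_mul_of_nonneg_left hb h0
  have hT : ∀ x y u, |T x u - T y u| ≤ lam * dist x y := by
    intro x y u
    by_cases hu : o u = true
    · simp only [hTd, hu, if_true]
      exact abs_sup'_sub_sup'_le (hS u) fun b _ => hF x y u b
    · simp only [hTd, hu]
      exact abs_inf'_sub_inf'_le (hS u) fun b _ => hF x y u b
  obtain ⟨x, hx⟩ := exists_fixedPt_of_abs_le h0 h1 T hT
  -- optimal choices
  choose σs hσs_mem hσs_max using fun u => Finset.exists_max_image (S u) (F x u) (hS u)
  choose τs hτs_mem hτs_min using fun u => Finset.exists_min_image (S u) (F x u) (hS u)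
  have hx_true : ∀ u, o u = true → x u = (S u).sup' (hS u) (F x u) := fun u hu => by
    have := congrFun hx u
    simp only [hTd, hu, if_true] at this
    exact this.symm
  have hx_false : ∀ u, o u = false → x u = (S u).inf' (hS u) (F x u) := fun u hu => by
    have := congrFun hx u
    simp only [hTd, hu, Bool.false_eq_true, if_false] at this
    exact this.symm
  have hsup : ∀ u, (S u).sup' (hS u) (F x u) = F x u (σs u) := fun u =>
    le_antisymm (Finset.sup'_le (hS u) (F x u) (hσs_max u)) (Finset.le_sup' (F x u) (hσs_mem u))
  have hinf : ∀ u, (S u).inf' (hS u) (F x u) = F x u (τs u) := fun u =>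
    le_antisymm (Finset.inf'_le (F x u) (hτs_mem u)) (Finset.le_inf' (hS u) (F x u) (hτs_min u))
  refine ⟨σs, τs, fun u => (hmemS u _).1 (hσs_mem u), fun u => (hmemS u _).1 (hτs_mem u), ?_⟩
  intro σ τ hσ hτ D₁ D₂ hD₁ hD₂
  -- `x` is a supersolution along `(σ, τs)` and a subsolution along `(σs, τ)`
  have key1 : ∀ u, (w u (positionalPlay o σ τs u) : ℝ) + lam * x (positionalPlay o σ τs u) ≤ x u := by
    intro u
    cases hu : o u
    · rw [positionalPlay_of_eq_false σ τs hu, hx_false u hu, hinf u]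
    · rw [positionalPlay_of_eq_true σ τs hu, hx_true u hu]
      exact Finset.le_sup' (F x u) ((hmemS u _).2 (hσ u hu))
  have key2 : ∀ u, x u ≤ (w u (positionalPlay o σs τ u) : ℝ) + lam * x (positionalPlay o σs τ u) := by
    intro u
    cases hu : o u
    · rw [positionalPlay_of_eq_false σs τ hu, hx_false u hu]
      exact Finset.inf'_le (F x u) ((hmemS u _).2 (hτ u hu))
    · rw [positionalPlay_of_eq_true σs τ hu, hx_true u hu, hsup u]
  intro u
  exact (discountedEval_le h0 h1 hD₁ key1 u).trans (le_discountedEval h0 h1 hD₂ key2 u)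

/-- **Saddle point in positional strategies for the cycle-mean payoff** (the heart of
positional determinacy): there are positional strategies `σ*`, `τ*`, legal everywhere, such
that for all legal positional `σ`, `τ` the mean weight of the lasso cycle of `(σ, τ*)` from `v`
is at most that of `(σ*, τ)`. Proof: discounted saddles for `λ_k = 1 - 1/(k+1)`, a pair
`(σ*, τ*)` optimal for infinitely many `k` (finitely many positional pairs), and the limit
`(1 - λ) · D_λ → ` cycle mean along that subsequence (Blackwell-type argument).
[cite: FijalkowEtAl2023GamesOnGraphs, Ch. 4 § "Discounted payoff games"; originally EhrenfeuchtMycielski1979] -/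
private theorem exists_cycleMean_saddle (o : V → Bool) (w : V → V → ℤ) (E : V → V → Prop)
    (hE : ∀ u, ∃ u', E u u') (v : V) :
    ∃ σs τs : V → V, (∀ u, E u (σs u)) ∧ (∀ u, E u (τs u)) ∧
      ∀ σ τ : V → V, (∀ u, o u = true → E u (σ u)) → (∀ u, o u = false → E u (τ u)) →
        (∑ u ∈ lassoCycle o σ τs v, (w u (positionalPlay o σ τs u) : ℝ)) /
            ((lassoCycle o σ τs v).card : ℝ) ≤
          (∑ u ∈ lassoCycle o σs τ v, (w u (positionalPlay o σs τ u) : ℝ)) /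
            ((lassoCycle o σs τ v).card : ℝ) := by
  -- discount factors `λ_k → 1`
  set lam : ℕ → ℝ := fun k => 1 - 1 / ((k : ℝ) + 1) with hlam
  have hlam0 : ∀ k, 0 ≤ lam k := fun k => by
    have hk : (1 : ℝ) / ((k : ℝ) + 1) ≤ 1 := by
      rw [div_le_one (by positivity)]; linarith [(Nat.cast_nonneg k : (0 : ℝ) ≤ k)]
    simp only [hlam]; linarith
  have hlam1 : ∀ k, lam k < 1 := fun k => by
    have hk : (0 : ℝ) < 1 / ((k : ℝ) + 1) := by positivity
    simp only [hlam]; linarith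
  have hlam_lim : Tendsto lam atTop (nhds 1) := by
    have := (tendsto_const_nhds (x := (1 : ℝ))).sub
      (tendsto_one_div_add_atTop_nhds_zero_nat (𝕜 := ℝ))
    simpa [hlam] using this
  -- discounted saddles, one for each `k`
  choose sσ sτ hsσ hsτ hsad using fun k => exists_discounted_saddle o w E hE (hlam0 k) (hlam1 k)
  -- a pair optimal for infinitely many `k`
  obtain ⟨⟨σs, τs⟩, hfreq⟩ : ∃ st : (V → V) × (V → V), ∃ᶠ k in atTop, (sσ k, sτ k) = st := by
    by_contra hcon
    have hall : ∀ᶠ k in atTop, ∀ st : (V → V) × (V → V), ¬(sσ k, sτ k) = st :=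
      Filter.eventually_all.2 fun st => Filter.not_frequently.1 fun hf => hcon ⟨st, hf⟩
    obtain ⟨k, hk⟩ := hall.exists
    exact hk _ rfl
  obtain ⟨φ, hφ, hφeq⟩ := Filter.extraction_of_frequently_atTop hfreq
  have hσeq : ∀ k, sσ (φ k) = σs := fun k => (Prod.mk.inj (hφeq k)).1
  have hτeq : ∀ k, sτ (φ k) = τs := fun k => (Prod.mk.inj (hφeq k)).2
  refine ⟨σs, τs, fun u => hσeq 0 ▸ hsσ (φ 0) u, fun u => hτeq 0 ▸ hsτ (φ 0) u, ?_⟩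
  intro σ τ hσ hτ
  obtain ⟨H₁, hH₁, hcl₁⟩ := discountedEval_closedForm (positionalPlay o σ τs)
    (fun u => (w u (positionalPlay o σ τs u) : ℝ)) v
  obtain ⟨H₂, hH₂, hcl₂⟩ := discountedEval_closedForm (positionalPlay o σs τ)
    (fun u => (w u (positionalPlay o σs τ u) : ℝ)) v
  rw [lassoCycle_eq_infinitelyOften, lassoCycle_eq_infinitelyOften]
  refine le_of_tendsto_of_tendsto' (hH₁.comp (hlam_lim.comp hφ.tendsto_atTop))
    (hH₂.comp (hlam_lim.comp hφ.tendsto_atTop)) fun k => ?_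
  obtain ⟨D₁, hD₁⟩ := exists_discountedEval (hlam0 (φ k)) (hlam1 (φ k)) (positionalPlay o σ τs)
    (fun u => (w u (positionalPlay o σ τs u) : ℝ))
  obtain ⟨D₂, hD₂⟩ := exists_discountedEval (hlam0 (φ k)) (hlam1 (φ k)) (positionalPlay o σs τ)
    (fun u => (w u (positionalPlay o σs τ u) : ℝ))
  simp only [Function.comp_apply]
  rw [← hcl₁ _ (hlam0 _) (hlam1 _) D₁ hD₁, ← hcl₂ _ (hlam0 _) (hlam1 _) D₂ hD₂]
  have hk := hsad (φ k)
  rw [hσeq k, hτeq k] at hk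
  exact mul_le_mul_of_nonneg_left (hk σ τ hσ hτ D₁ D₂ hD₁ hD₂ v) (by linarith [hlam1 (φ k)])

end DeterminacyProof

/-- **Positional determinacy of mean-payoff games in the threshold form, proved**
(discharges the named fact `EhrenfeuchtMycielski1979_thresholdDichotomy`). The proof is not
the first-cycle-game argument of the cited corollary but the discounted-game road: Banach
fixed point of the contracting one-step operator and its argmax/argmin positional strategies
(Games on Graphs, Ch. 4 § "Discounted payoff games", Lemma "Values as unique fixed point"),
the lasso computation `(1-λ) ∑ λ^i w_i → ` cycle mean (ibid., opening of that section), and a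
pigeonhole over the finitely many positional strategy pairs as `λ → 1`; integrality of weights
and threshold is used only to state the conclusion division-free.
[cite: FijalkowEtAl2023GamesOnGraphs, Ch. 4 § "Proving positional determinacy over finite arenas", Cor. "Positional determinacy of mean payoff" and § "Discounted payoff games", Lemma "Values as unique fixed point"; originally EhrenfeuchtMycielski1979] -/
theorem EhrenfeuchtMycielski1979_thresholdDichotomy_holds :
    EhrenfeuchtMycielski1979_thresholdDichotomy.{u} := by
  intro V _ o w E hE v θ
  obtain ⟨σs, τs, hσs, hτs, hsad⟩ := exists_cycleMean_saddle o w E hE v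
  by_cases h : ∃ σ : V → V, (∀ u, o u = true → E u (σ u)) ∧
      θ * ((lassoCycle o σ τs v).card : ℤ) ≤ ∑ u ∈ lassoCycle o σ τs v, w u (positionalPlay o σ τs u)
  · obtain ⟨σ, hσ, hθ⟩ := h
    refine Or.inl ⟨σs, fun u _ => hσs u, fun τ hτ => ?_⟩
    have hreal := hsad σ τ hσ hτ
    have hc₁ : (0 : ℝ) < ((lassoCycle o σ τs v).card : ℝ) :=
      Nat.cast_pos.2 (card_lassoCycle_pos o σ τs v)
    have hc₂ : (0 : ℝ) < ((lassoCycle o σs τ v).card : ℝ) :=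
      Nat.cast_pos.2 (card_lassoCycle_pos o σs τ v)
    have h1 : (θ : ℝ) ≤ (∑ u ∈ lassoCycle o σ τs v, (w u (positionalPlay o σ τs u) : ℝ)) /
        ((lassoCycle o σ τs v).card : ℝ) := by
      rw [le_div_iff₀ hc₁]
      exact_mod_cast hθ
    have h2 := h1.trans hreal
    rw [le_div_iff₀ hc₂] at h2
    exact_mod_cast h2
  · refine Or.inr ⟨τs, fun u _ => hτs u, fun σ hσ => ?_⟩
    exact lt_of_not_ge fun hle => h ⟨σ, hσ, hle⟩

end MeanPayoffGame

end Literature.Combinatorics.Games
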